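/-
Copyright (c) 2026 the pub-hodgecm-mathlib formalisation cell (harness21).  Prover seat hodgecm-mathlib-B-p14 (g32) — (R2) glue ∕ assembly heir, 2026-09-01.
«EP-RAM-PKG»: the (R2) per-place package on `U(Φ₂)(L⁺_v)` at the levels `(K♯_D, K, K♯_D ⊓ K)` of a (tamely) RAMIFIED non-split place, statement-first
(EP pen heir B-p04 (g35) 09:55:52Z ASK 2; A-p06 (g27) census `CENSUS-R2ram-RamifiedEulerPoincare` (D5) ∕ §2; architect A-p16 A-18 pins).
-/
import Literature.NumberTheory.Rogawski1990.RankOneEulerPoincareGlueRankOne          -- ★ (B-p14 g31) the glue on `U₂`: `exists_isLocSmooth_classOrbitalIntegral_eq_one_zero_of_relations_two`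
import Literature.NumberTheory.Automorphic.CompactCoreCentralizerUnitary            -- ★ `isClosedEmbedding_subtype_comp_localNonsplitEquiv` (the one-place model is a closed embedding into `GL₂(L_w)`)
import Literature.NumberTheory.Automorphic.FixedCosetsFiniteOfCompactCentralizer    -- ★ (B-p04 g35) `isCompact_map_conj`, `isOpen_map_conj`
import Literature.NumberTheory.Automorphic.SatakeParameterGenericBoundFlathProofs   -- ★ `isCompact_glInt_adicCompletion`, `isOpen_glInt_adicCompletion`
import HarnessLib

/-!
# The Euler–Poincaré relations package on `U(Φ₂)(L⁺_v)` at the levels of a ramified place: vertex stabiliser, edge stabiliser, flag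

Topic `NumberTheory/Rogawski1990`, namespace `Literature.NumberTheory.Rogawski1990` (§2–§3; §1 in `…Automorphic.UnitaryGroup`).  THEOREMS ONLY: no definition,
no named fact, no instance, no notation, no `sorry`; kernel lane.

THE MATHEMATICS [Kottwitz1988, §2; Serre1980Trees, II.1.1; A-p06 (g27) census (D1)–(D5), §2].  `L` CM, `v` non-split in `L`, `w ∣ v` (`w̄ = w`),
`U₂ := U(Φ₂)(L⁺_v) = (cmDatum L 2 Φ₂).Local v ≃ₜ* U_w := U(σ_w, (Φ₂)_w)(L_w)` (★ `localNonsplitEquiv =: e_w`).  At a TAMELY RAMIFIED `w` the inclusion graph of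
self-dual and `η`-modular lattices (`η` an anti-fixed uniformiser, `σ_w η = −η`, ★ `exists_uniformizer_galAdicCompletionMap_complexConj_eq_neg_of_ramified`) is the
barycentric subdivision of the tree of `U(1,1)`: VERTICES = `η`-modular lattices (stabiliser `K♯ = U_w ∩ D_η GL₂(𝒪_w) D_η⁻¹`, `D_η = diag(1, η)`), EDGE MIDPOINTS =
self-dual lattices (stabiliser `K = U_w ∩ GL₂(𝒪_w)`, containing the inversion `Φ₂`), HALF-EDGES = flags (stabiliser `K♯ ⊓ K`).  Kottwitz's Euler–Poincaré
function needs no orientation character on the subdivision, and the (R2) glue ★ `exists_isLocSmooth_classOrbitalIntegral_eq_one_zero_of_relations_two` applies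
VERBATIM with `(K, K′, I) ↦ (K♯, K, K♯ ⊓ K)`.  THIS FILE (pure packaging; NO ramification hypothesis is used, `D ∈ GL₂(L_w)` arbitrary): §1 the vertex level
`K♯_D := (D GL₂(𝒪_w) D⁻¹).comap (U_w.subtype ∘ e_w) ≤ U₂` — membership through the one-place model (`Iff.rfl`), compact and open (★ `isCompact∕isOpen_glInt_adicCompletion`,
★ `isCompact∕isOpen_map_conj`, ★ `isClosedEmbedding_subtype_comp_localNonsplitEquiv`), and the flag level `K♯_D ⊓ K` likewise (`K := cmLocalIntegralLevel`, ★
`isCompact_isOpen_cmLocalIntegralLevel`); §2 the per-place hypothesis `∃ K₁ K₂ I, open ∧ compact ×3 ∧ (E) ∧ (N)` of ★ `rankOneEulerPoincareNonsplit_of_relations` from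
(E) and (N) at `(K♯_D, K, K♯_D ⊓ K)` given as hypotheses; §3 the letter's per-place body `∃ f ∈ C_c^∞, Φ = 1 ∕ 0`.  CONSUMERS: (E)-ram = EP pen heir B-p04 (g35)'s
ramified (T4)-corollary (★ A-p17 `natCard_fixedBy_add_eq_natCard_fixedBy_add_one_congr` over ★ A-p06 (hA)(hB)(hI)-ramified + ★ finiteness p843428, `g₁ := D_η`;
(T4)'s `#Fix(⧸C) + #Fix(⧸C′)` with `C ↔ GL₂(𝒪_w)`, `C′ ↔ D_η GL₂(𝒪_w) D_η⁻¹` is `hE` after `add_comm`); (N)-ram = A-p06 (g27) (N2) («fixed vertices = fixed edges per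
period of the split torus»); LETTER ⟸ ★ `rankOneEulerPoincareNonsplit_of_dyadic_of_ramified` (B-p14 p843462).
HONEST LABEL: HC_CM is proved only modulo the cell's remaining named inputs (hLiu418, h413) until rung 0 closes; this file is unconditional.

## References
* [Kottwitz1988] R. E. Kottwitz, *Tamagawa numbers*, Ann. of Math. 127 (1988), 629–646, §2 Theorem 2.
* [Serre1980Trees] J.-P. Serre, *Trees* (1980), Ch. II §1.1 (the tree; barycentric subdivision at a group with inversions).
* [Rogawski1990] J. D. Rogawski, *Automorphic Representations of Unitary Groups in Three Variables* (1990), §12.6 p. 174.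
* [PlatonovRapinchuk1994] V. Platonov, A. Rapinchuk, *Algebraic Groups and Number Theory* (1994), §5.1 (one-place models).
-/

set_option autoImplicit false

noncomputable section

open scoped ValuativeRel Matrix MatrixGroups
open Matrix ValuativeRel NumberField IsDedekindDomain MulAction MeasureTheory Measure Topology

namespace Literature.NumberTheory.Automorphic.UnitaryGroup

/-! ## §1 The vertex level `K♯_D` and the flag level `K♯_D ⊓ K` on `U₂`: membership, compact, open -/

section Levels

variable (L : Type) [Field L] [NumberField L] [IsCMField L] {v : HeightOneSpectrum (𝓞 ↥(maximalRealSubfield L))}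
  (w : PlacesOver L v) (hw : IsCMField.complexConj L • w.1 = w.1) (D : GL (Fin 2) (w.1.adicCompletion L))

/-- **`K♯_D` through the one-place model**: `g ∈ K♯_D ↔ (e_w g)` lies in `D GL₂(𝒪_w) D⁻¹` (definitional). [cite: PlatonovRapinchuk1994, §5.1] [cite: Kottwitz1988, §2] -/
theorem mem_comap_map_conj_glInt_iff (g : (cmDatum L 2 (Matrix.of fun i j : Fin 2 => if i.val + j.val + 1 = 2 then (1 : L) else 0)).Local v) :
    g ∈ (((glInt 2 (w.1.adicCompletion L)).map (MulAut.conj D).toMonoidHom).comap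
          (((unitaryGroupOfForm (galAdicCompletionMap (L := L) (IsCMField.complexConj L) hw)
            (placeForm (Matrix.of fun i j : Fin 2 => if i.val + j.val + 1 = 2 then (1 : L) else 0) w.1)).subtype.comp
            (localNonsplitEquiv (IsCMField.complexConj L) (Matrix.of fun i j : Fin 2 => if i.val + j.val + 1 = 2 then (1 : L) else 0)
          (IsCMField.complexConj_ne_one L) w hw).toMonoidHom :
            (cmDatum L 2 (Matrix.of fun i j : Fin 2 => if i.val + j.val + 1 = 2 then (1 : L) else 0)).Local v →* GL (Fin 2) (w.1.adicCompletion L)))) ↔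
      (((localNonsplitEquiv (IsCMField.complexConj L) (Matrix.of fun i j : Fin 2 => if i.val + j.val + 1 = 2 then (1 : L) else 0)
          (IsCMField.complexConj_ne_one L) w hw) g : ↥(unitaryGroupOfForm (galAdicCompletionMap (L := L) (IsCMField.complexConj L) hw)
            (placeForm (Matrix.of fun i j : Fin 2 => if i.val + j.val + 1 = 2 then (1 : L) else 0) w.1))) : GL (Fin 2) (w.1.adicCompletion L)) ∈
        (glInt 2 (w.1.adicCompletion L)).map (MulAut.conj D).toMonoidHom :=
  Iff.rfl

include hw in
/-- **`K♯_D` is compact and open in `U₂`**: `D GL₂(𝒪_w) D⁻¹` is compact open in `GL₂(L_w)` and `U₂ → GL₂(L_w)`, `g ↦ e_w g`, is a closed embedding.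
[cite: PlatonovRapinchuk1994, §5.1] [cite: Kottwitz1988, §2] -/
theorem isCompact_isOpen_comap_map_conj_glInt :
    IsCompact (((((glInt 2 (w.1.adicCompletion L)).map (MulAut.conj D).toMonoidHom).comap
          (((unitaryGroupOfForm (galAdicCompletionMap (L := L) (IsCMField.complexConj L) hw)
            (placeForm (Matrix.of fun i j : Fin 2 => if i.val + j.val + 1 = 2 then (1 : L) else 0) w.1)).subtype.comp
            (localNonsplitEquiv (IsCMField.complexConj L) (Matrix.of fun i j : Fin 2 => if i.val + j.val + 1 = 2 then (1 : L) else 0)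
          (IsCMField.complexConj_ne_one L) w hw).toMonoidHom :
            (cmDatum L 2 (Matrix.of fun i j : Fin 2 => if i.val + j.val + 1 = 2 then (1 : L) else 0)).Local v →* GL (Fin 2) (w.1.adicCompletion L)))) : Subgroup ((cmDatum L 2 (Matrix.of fun i j : Fin 2 => if i.val + j.val + 1 = 2 then (1 : L) else 0)).Local v)) : Set ((cmDatum L 2 (Matrix.of fun i j : Fin 2 => if i.val + j.val + 1 = 2 then (1 : L) else 0)).Local v)) ∧
      IsOpen (((((glInt 2 (w.1.adicCompletion L)).map (MulAut.conj D).toMonoidHom).comap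
          (((unitaryGroupOfForm (galAdicCompletionMap (L := L) (IsCMField.complexConj L) hw)
            (placeForm (Matrix.of fun i j : Fin 2 => if i.val + j.val + 1 = 2 then (1 : L) else 0) w.1)).subtype.comp
            (localNonsplitEquiv (IsCMField.complexConj L) (Matrix.of fun i j : Fin 2 => if i.val + j.val + 1 = 2 then (1 : L) else 0)
          (IsCMField.complexConj_ne_one L) w hw).toMonoidHom :
            (cmDatum L 2 (Matrix.of fun i j : Fin 2 => if i.val + j.val + 1 = 2 then (1 : L) else 0)).Local v →* GL (Fin 2) (w.1.adicCompletion L)))) : Subgroup ((cmDatum L 2 (Matrix.of fun i j : Fin 2 => if i.val + j.val + 1 = 2 then (1 : L) else 0)).Local v)) : Set ((cmDatum L 2 (Matrix.of fun i j : Fin 2 => if i.val + j.val + 1 = 2 then (1 : L) else 0)).Local v)) := by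
  haveI : Algebra.IsQuadraticExtension ↥(maximalRealSubfield L) L := IsCMField.isQuadraticExtension L
  have hφ := isClosedEmbedding_subtype_comp_localNonsplitEquiv (IsCMField.complexConj L) 2
    (Matrix.of fun i j : Fin 2 => if i.val + j.val + 1 = 2 then (1 : L) else 0) (IsCMField.complexConj_ne_one L) w hw
  have hc := isCompact_map_conj (glInt 2 (w.1.adicCompletion L)) (isCompact_glInt_adicCompletion 2 L w.1) D
  have ho := isOpen_map_conj (glInt 2 (w.1.adicCompletion L)) (isOpen_glInt_adicCompletion 2 L w.1) D
  rw [Subgroup.coe_comap]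
  exact ⟨hφ.isCompact_preimage hc, ho.preimage hφ.continuous⟩

include hw in
/-- **The flag level `K♯_D ⊓ K` is compact and open in `U₂`** (`K = U(Φ₂)(𝒪_v)` ★ `isCompact_isOpen_cmLocalIntegralLevel`). [cite: Kottwitz1988, §2] -/
theorem isCompact_isOpen_comap_map_conj_glInt_inf_cmLocalIntegralLevel :
    IsCompact (((((glInt 2 (w.1.adicCompletion L)).map (MulAut.conj D).toMonoidHom).comap
          (((unitaryGroupOfForm (galAdicCompletionMap (L := L) (IsCMField.complexConj L) hw)
            (placeForm (Matrix.of fun i j : Fin 2 => if i.val + j.val + 1 = 2 then (1 : L) else 0) w.1)).subtype.comp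
            (localNonsplitEquiv (IsCMField.complexConj L) (Matrix.of fun i j : Fin 2 => if i.val + j.val + 1 = 2 then (1 : L) else 0)
          (IsCMField.complexConj_ne_one L) w hw).toMonoidHom :
            (cmDatum L 2 (Matrix.of fun i j : Fin 2 => if i.val + j.val + 1 = 2 then (1 : L) else 0)).Local v →* GL (Fin 2) (w.1.adicCompletion L)))) ⊓
        cmLocalIntegralLevel L 2 (Matrix.of fun i j : Fin 2 => if i.val + j.val + 1 = 2 then (1 : L) else 0) v : Subgroup ((cmDatum L 2 (Matrix.of fun i j : Fin 2 => if i.val + j.val + 1 = 2 then (1 : L) else 0)).Local v)) : Set ((cmDatum L 2 (Matrix.of fun i j : Fin 2 => if i.val + j.val + 1 = 2 then (1 : L) else 0)).Local v)) ∧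
      IsOpen (((((glInt 2 (w.1.adicCompletion L)).map (MulAut.conj D).toMonoidHom).comap
          (((unitaryGroupOfForm (galAdicCompletionMap (L := L) (IsCMField.complexConj L) hw)
            (placeForm (Matrix.of fun i j : Fin 2 => if i.val + j.val + 1 = 2 then (1 : L) else 0) w.1)).subtype.comp
            (localNonsplitEquiv (IsCMField.complexConj L) (Matrix.of fun i j : Fin 2 => if i.val + j.val + 1 = 2 then (1 : L) else 0)
          (IsCMField.complexConj_ne_one L) w hw).toMonoidHom :
            (cmDatum L 2 (Matrix.of fun i j : Fin 2 => if i.val + j.val + 1 = 2 then (1 : L) else 0)).Local v →* GL (Fin 2) (w.1.adicCompletion L)))) ⊓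
        cmLocalIntegralLevel L 2 (Matrix.of fun i j : Fin 2 => if i.val + j.val + 1 = 2 then (1 : L) else 0) v : Subgroup ((cmDatum L 2 (Matrix.of fun i j : Fin 2 => if i.val + j.val + 1 = 2 then (1 : L) else 0)).Local v)) : Set ((cmDatum L 2 (Matrix.of fun i j : Fin 2 => if i.val + j.val + 1 = 2 then (1 : L) else 0)).Local v)) := by
  obtain ⟨hSc, hSo⟩ := isCompact_isOpen_comap_map_conj_glInt L w hw D
  obtain ⟨hKc, hKo⟩ := isCompact_isOpen_cmLocalIntegralLevel L 2 (Matrix.of fun i j : Fin 2 => if i.val + j.val + 1 = 2 then (1 : L) else 0) v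
  rw [Subgroup.coe_inf]
  exact ⟨hSc.inter_right (Subgroup.isClosed_of_isOpen _ hKo), hSo.inter hKo⟩

end Levels

end Literature.NumberTheory.Automorphic.UnitaryGroup

namespace Literature.NumberTheory.Rogawski1990

open Literature.NumberTheory.Automorphic Literature.NumberTheory.Automorphic.UnitaryGroup

/-! ## §2 The relations package from (E) and (N) at `(K♯_D, K, K♯_D ⊓ K)` -/

section Package

variable (L : Type) [Field L] [NumberField L] [IsCMField L] {v : HeightOneSpectrum (𝓞 ↥(maximalRealSubfield L))}
  (w : PlacesOver L v) (hw : IsCMField.complexConj L • w.1 = w.1) (D : GL (Fin 2) (w.1.adicCompletion L))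

  [MeasurableSpace ((cmDatum L 2 (Matrix.of fun i j : Fin 2 => if i.val + j.val + 1 = 2 then (1 : L) else 0)).Local v)]
  [BorelSpace ((cmDatum L 2 (Matrix.of fun i j : Fin 2 => if i.val + j.val + 1 = 2 then (1 : L) else 0)).Local v)]
  [∀ γ : (cmDatum L 2 (Matrix.of fun i j : Fin 2 => if i.val + j.val + 1 = 2 then (1 : L) else 0)).Local v,
    MeasurableSpace (((cmDatum L 2 (Matrix.of fun i j : Fin 2 => if i.val + j.val + 1 = 2 then (1 : L) else 0)).Local v) ⧸
      Subgroup.centralizer ({γ} : Set ((cmDatum L 2 (Matrix.of fun i j : Fin 2 => if i.val + j.val + 1 = 2 then (1 : L) else 0)).Local v)))]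
  [∀ γ : (cmDatum L 2 (Matrix.of fun i j : Fin 2 => if i.val + j.val + 1 = 2 then (1 : L) else 0)).Local v,
    BorelSpace (((cmDatum L 2 (Matrix.of fun i j : Fin 2 => if i.val + j.val + 1 = 2 then (1 : L) else 0)).Local v) ⧸
      Subgroup.centralizer ({γ} : Set ((cmDatum L 2 (Matrix.of fun i j : Fin 2 => if i.val + j.val + 1 = 2 then (1 : L) else 0)).Local v)))]
  (ν : Measure ((cmDatum L 2 (Matrix.of fun i j : Fin 2 => if i.val + j.val + 1 = 2 then (1 : L) else 0)).Local v))
  [IsHaarMeasure ν] [ν.IsMulRightInvariant]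

omit [BorelSpace ((cmDatum L 2 (Matrix.of fun i j : Fin 2 => if i.val + j.val + 1 = 2 then (1 : L) else 0)).Local v)]
  [∀ γ : (cmDatum L 2 (Matrix.of fun i j : Fin 2 => if i.val + j.val + 1 = 2 then (1 : L) else 0)).Local v,
    BorelSpace (((cmDatum L 2 (Matrix.of fun i j : Fin 2 => if i.val + j.val + 1 = 2 then (1 : L) else 0)).Local v) ⧸
      Subgroup.centralizer ({γ} : Set ((cmDatum L 2 (Matrix.of fun i j : Fin 2 => if i.val + j.val + 1 = 2 then (1 : L) else 0)).Local v)))]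
  [IsHaarMeasure ν] [ν.IsMulRightInvariant] in
include hw in
/-- **THE (R2) RELATIONS PACKAGE FROM (E) AND (N) AT THE RAMIFIED LEVELS `(K♯_D, K, K♯_D ⊓ K)`** — the per-place hypothesis of ★ `rankOneEulerPoincareNonsplit_of_relations`
at `(L, v)`: given Kottwitz's elliptic relation `#Fix(U₂⧸K♯_D) + #Fix(U₂⧸K) = #Fix(U₂⧸(K♯_D ⊓ K)) + 1` at every regular elliptic class (`hE`) and the non-elliptic
relation `(vol K♯_D)⁻¹Φ(𝟙_{K♯_D}) + (vol K)⁻¹Φ(𝟙_K) − (vol (K♯_D ⊓ K))⁻¹Φ(𝟙_{K♯_D ⊓ K}) = 0` at every regular non-elliptic class (`hN`), the package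
`∃ K₁ K₂ I, open ∧ compact ×3 ∧ (E) ∧ (N)` holds (§1 supplies open∕compact).  At a tamely ramified `w` take `D := D_η = diag(1, η)`, `η` anti-fixed.
[cite: Kottwitz1988, §2 Theorem 2] [cite: Serre1980Trees, II.1.1] [cite: Rogawski1990, §12.6 p. 174] -/
theorem exists_epRelations_of_vertexEdgeLevels
    {m : OrbitalMeasureFamily ((cmDatum L 2 (Matrix.of fun i j : Fin 2 => if i.val + j.val + 1 = 2 then (1 : L) else 0)).Local v)}
    (hE : ∀ γ : (cmDatum L 2 (Matrix.of fun i j : Fin 2 => if i.val + j.val + 1 = 2 then (1 : L) else 0)).Local v,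
      IsRegularElt (γ.val : GL (Fin 2) (UnitaryGroup.LocalRing L v)) →
      CompactSpace (Subgroup.centralizer ({γ} : Set ((cmDatum L 2 (Matrix.of fun i j : Fin 2 => if i.val + j.val + 1 = 2 then (1 : L) else 0)).Local v))) →
      Nat.card (fixedBy ((cmDatum L 2 (Matrix.of fun i j : Fin 2 => if i.val + j.val + 1 = 2 then (1 : L) else 0)).Local v ⧸
          (((glInt 2 (w.1.adicCompletion L)).map (MulAut.conj D).toMonoidHom).comap
          (((unitaryGroupOfForm (galAdicCompletionMap (L := L) (IsCMField.complexConj L) hw)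
            (placeForm (Matrix.of fun i j : Fin 2 => if i.val + j.val + 1 = 2 then (1 : L) else 0) w.1)).subtype.comp
            (localNonsplitEquiv (IsCMField.complexConj L) (Matrix.of fun i j : Fin 2 => if i.val + j.val + 1 = 2 then (1 : L) else 0)
          (IsCMField.complexConj_ne_one L) w hw).toMonoidHom :
            (cmDatum L 2 (Matrix.of fun i j : Fin 2 => if i.val + j.val + 1 = 2 then (1 : L) else 0)).Local v →* GL (Fin 2) (w.1.adicCompletion L))))) γ) +
        Nat.card (fixedBy ((cmDatum L 2 (Matrix.of fun i j : Fin 2 => if i.val + j.val + 1 = 2 then (1 : L) else 0)).Local v ⧸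
          cmLocalIntegralLevel L 2 (Matrix.of fun i j : Fin 2 => if i.val + j.val + 1 = 2 then (1 : L) else 0) v) γ) =
        Nat.card (fixedBy ((cmDatum L 2 (Matrix.of fun i j : Fin 2 => if i.val + j.val + 1 = 2 then (1 : L) else 0)).Local v ⧸
          ((((glInt 2 (w.1.adicCompletion L)).map (MulAut.conj D).toMonoidHom).comap
          (((unitaryGroupOfForm (galAdicCompletionMap (L := L) (IsCMField.complexConj L) hw)
            (placeForm (Matrix.of fun i j : Fin 2 => if i.val + j.val + 1 = 2 then (1 : L) else 0) w.1)).subtype.comp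
            (localNonsplitEquiv (IsCMField.complexConj L) (Matrix.of fun i j : Fin 2 => if i.val + j.val + 1 = 2 then (1 : L) else 0)
          (IsCMField.complexConj_ne_one L) w hw).toMonoidHom :
            (cmDatum L 2 (Matrix.of fun i j : Fin 2 => if i.val + j.val + 1 = 2 then (1 : L) else 0)).Local v →* GL (Fin 2) (w.1.adicCompletion L)))) ⊓
            cmLocalIntegralLevel L 2 (Matrix.of fun i j : Fin 2 => if i.val + j.val + 1 = 2 then (1 : L) else 0) v)) γ) + 1)
    (hN : ∀ γ : (cmDatum L 2 (Matrix.of fun i j : Fin 2 => if i.val + j.val + 1 = 2 then (1 : L) else 0)).Local v,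
      IsRegularElt (γ.val : GL (Fin 2) (UnitaryGroup.LocalRing L v)) →
      ¬ CompactSpace (Subgroup.centralizer ({γ} : Set ((cmDatum L 2 (Matrix.of fun i j : Fin 2 => if i.val + j.val + 1 = 2 then (1 : L) else 0)).Local v))) →
      (((ν ((((glInt 2 (w.1.adicCompletion L)).map (MulAut.conj D).toMonoidHom).comap
          (((unitaryGroupOfForm (galAdicCompletionMap (L := L) (IsCMField.complexConj L) hw)
            (placeForm (Matrix.of fun i j : Fin 2 => if i.val + j.val + 1 = 2 then (1 : L) else 0) w.1)).subtype.comp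
            (localNonsplitEquiv (IsCMField.complexConj L) (Matrix.of fun i j : Fin 2 => if i.val + j.val + 1 = 2 then (1 : L) else 0)
          (IsCMField.complexConj_ne_one L) w hw).toMonoidHom :
            (cmDatum L 2 (Matrix.of fun i j : Fin 2 => if i.val + j.val + 1 = 2 then (1 : L) else 0)).Local v →* GL (Fin 2) (w.1.adicCompletion L)))))).toReal : ℂ))⁻¹ *
          classOrbitalIntegral m
            ((((((glInt 2 (w.1.adicCompletion L)).map (MulAut.conj D).toMonoidHom).comap
          (((unitaryGroupOfForm (galAdicCompletionMap (L := L) (IsCMField.complexConj L) hw)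
            (placeForm (Matrix.of fun i j : Fin 2 => if i.val + j.val + 1 = 2 then (1 : L) else 0) w.1)).subtype.comp
            (localNonsplitEquiv (IsCMField.complexConj L) (Matrix.of fun i j : Fin 2 => if i.val + j.val + 1 = 2 then (1 : L) else 0)
          (IsCMField.complexConj_ne_one L) w hw).toMonoidHom :
            (cmDatum L 2 (Matrix.of fun i j : Fin 2 => if i.val + j.val + 1 = 2 then (1 : L) else 0)).Local v →* GL (Fin 2) (w.1.adicCompletion L)))) : Subgroup ((cmDatum L 2 (Matrix.of fun i j : Fin 2 => if i.val + j.val + 1 = 2 then (1 : L) else 0)).Local v)) : Set ((cmDatum L 2 (Matrix.of fun i j : Fin 2 => if i.val + j.val + 1 = 2 then (1 : L) else 0)).Local v)).indicator fun _ => (1 : ℂ))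
            (ConjClasses.mk γ) +
        (((ν (cmLocalIntegralLevel L 2 (Matrix.of fun i j : Fin 2 => if i.val + j.val + 1 = 2 then (1 : L) else 0) v)).toReal : ℂ))⁻¹ *
          classOrbitalIntegral m
            (((cmLocalIntegralLevel L 2 (Matrix.of fun i j : Fin 2 => if i.val + j.val + 1 = 2 then (1 : L) else 0) v) : Set ((cmDatum L 2 (Matrix.of fun i j : Fin 2 => if i.val + j.val + 1 = 2 then (1 : L) else 0)).Local v)).indicator fun _ => (1 : ℂ))
            (ConjClasses.mk γ) -
        (((ν ((((glInt 2 (w.1.adicCompletion L)).map (MulAut.conj D).toMonoidHom).comap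
          (((unitaryGroupOfForm (galAdicCompletionMap (L := L) (IsCMField.complexConj L) hw)
            (placeForm (Matrix.of fun i j : Fin 2 => if i.val + j.val + 1 = 2 then (1 : L) else 0) w.1)).subtype.comp
            (localNonsplitEquiv (IsCMField.complexConj L) (Matrix.of fun i j : Fin 2 => if i.val + j.val + 1 = 2 then (1 : L) else 0)
          (IsCMField.complexConj_ne_one L) w hw).toMonoidHom :
            (cmDatum L 2 (Matrix.of fun i j : Fin 2 => if i.val + j.val + 1 = 2 then (1 : L) else 0)).Local v →* GL (Fin 2) (w.1.adicCompletion L)))) ⊓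
            cmLocalIntegralLevel L 2 (Matrix.of fun i j : Fin 2 => if i.val + j.val + 1 = 2 then (1 : L) else 0) v)).toReal : ℂ))⁻¹ *
          classOrbitalIntegral m
            ((((((glInt 2 (w.1.adicCompletion L)).map (MulAut.conj D).toMonoidHom).comap
          (((unitaryGroupOfForm (galAdicCompletionMap (L := L) (IsCMField.complexConj L) hw)
            (placeForm (Matrix.of fun i j : Fin 2 => if i.val + j.val + 1 = 2 then (1 : L) else 0) w.1)).subtype.comp
            (localNonsplitEquiv (IsCMField.complexConj L) (Matrix.of fun i j : Fin 2 => if i.val + j.val + 1 = 2 then (1 : L) else 0)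
          (IsCMField.complexConj_ne_one L) w hw).toMonoidHom :
            (cmDatum L 2 (Matrix.of fun i j : Fin 2 => if i.val + j.val + 1 = 2 then (1 : L) else 0)).Local v →* GL (Fin 2) (w.1.adicCompletion L)))) ⊓
              cmLocalIntegralLevel L 2 (Matrix.of fun i j : Fin 2 => if i.val + j.val + 1 = 2 then (1 : L) else 0) v : Subgroup ((cmDatum L 2 (Matrix.of fun i j : Fin 2 => if i.val + j.val + 1 = 2 then (1 : L) else 0)).Local v)) : Set ((cmDatum L 2 (Matrix.of fun i j : Fin 2 => if i.val + j.val + 1 = 2 then (1 : L) else 0)).Local v)).indicator fun _ => (1 : ℂ))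
            (ConjClasses.mk γ) = 0) :
    ∃ K K' I : Subgroup ((cmDatum L 2 (Matrix.of fun i j : Fin 2 => if i.val + j.val + 1 = 2 then (1 : L) else 0)).Local v),
      IsOpen (K : Set ((cmDatum L 2 (Matrix.of fun i j : Fin 2 => if i.val + j.val + 1 = 2 then (1 : L) else 0)).Local v)) ∧
      IsCompact (K : Set ((cmDatum L 2 (Matrix.of fun i j : Fin 2 => if i.val + j.val + 1 = 2 then (1 : L) else 0)).Local v)) ∧
      IsOpen (K' : Set ((cmDatum L 2 (Matrix.of fun i j : Fin 2 => if i.val + j.val + 1 = 2 then (1 : L) else 0)).Local v)) ∧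
      IsCompact (K' : Set ((cmDatum L 2 (Matrix.of fun i j : Fin 2 => if i.val + j.val + 1 = 2 then (1 : L) else 0)).Local v)) ∧
      IsOpen (I : Set ((cmDatum L 2 (Matrix.of fun i j : Fin 2 => if i.val + j.val + 1 = 2 then (1 : L) else 0)).Local v)) ∧
      IsCompact (I : Set ((cmDatum L 2 (Matrix.of fun i j : Fin 2 => if i.val + j.val + 1 = 2 then (1 : L) else 0)).Local v)) ∧
      (∀ γ : (cmDatum L 2 (Matrix.of fun i j : Fin 2 => if i.val + j.val + 1 = 2 then (1 : L) else 0)).Local v,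
        IsRegularElt (γ.val : GL (Fin 2) (UnitaryGroup.LocalRing L v)) →
        CompactSpace (Subgroup.centralizer
          ({γ} : Set ((cmDatum L 2 (Matrix.of fun i j : Fin 2 => if i.val + j.val + 1 = 2 then (1 : L) else 0)).Local v))) →
        Nat.card (fixedBy ((cmDatum L 2 (Matrix.of fun i j : Fin 2 => if i.val + j.val + 1 = 2 then (1 : L) else 0)).Local v ⧸ K) γ) +
          Nat.card (fixedBy ((cmDatum L 2 (Matrix.of fun i j : Fin 2 => if i.val + j.val + 1 = 2 then (1 : L) else 0)).Local v ⧸ K') γ) =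
          Nat.card (fixedBy ((cmDatum L 2 (Matrix.of fun i j : Fin 2 => if i.val + j.val + 1 = 2 then (1 : L) else 0)).Local v ⧸ I) γ) + 1) ∧
      (∀ γ : (cmDatum L 2 (Matrix.of fun i j : Fin 2 => if i.val + j.val + 1 = 2 then (1 : L) else 0)).Local v,
        IsRegularElt (γ.val : GL (Fin 2) (UnitaryGroup.LocalRing L v)) →
        ¬ CompactSpace (Subgroup.centralizer
          ({γ} : Set ((cmDatum L 2 (Matrix.of fun i j : Fin 2 => if i.val + j.val + 1 = 2 then (1 : L) else 0)).Local v))) →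
        (((ν K).toReal : ℂ))⁻¹ * classOrbitalIntegral m
            ((K : Set ((cmDatum L 2 (Matrix.of fun i j : Fin 2 => if i.val + j.val + 1 = 2 then (1 : L) else 0)).Local v)).indicator fun _ => (1 : ℂ))
            (ConjClasses.mk γ) +
          (((ν K').toReal : ℂ))⁻¹ * classOrbitalIntegral m
            ((K' : Set ((cmDatum L 2 (Matrix.of fun i j : Fin 2 => if i.val + j.val + 1 = 2 then (1 : L) else 0)).Local v)).indicator fun _ => (1 : ℂ))
            (ConjClasses.mk γ) -
          (((ν I).toReal : ℂ))⁻¹ * classOrbitalIntegral m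
            ((I : Set ((cmDatum L 2 (Matrix.of fun i j : Fin 2 => if i.val + j.val + 1 = 2 then (1 : L) else 0)).Local v)).indicator fun _ => (1 : ℂ))
            (ConjClasses.mk γ) = 0) := by
  obtain ⟨hSc, hSo⟩ := isCompact_isOpen_comap_map_conj_glInt L w hw D
  obtain ⟨hKc, hKo⟩ := isCompact_isOpen_cmLocalIntegralLevel L 2 (Matrix.of fun i j : Fin 2 => if i.val + j.val + 1 = 2 then (1 : L) else 0) v
  obtain ⟨hIc, hIo⟩ := isCompact_isOpen_comap_map_conj_glInt_inf_cmLocalIntegralLevel L w hw D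
  exact ⟨_, _, _, hSo, hSc, hKo, hKc, hIo, hIc, hE, hN⟩

/-! ## §3 The Euler–Poincaré function from (E) and (N) at `(K♯_D, K, K♯_D ⊓ K)` -/

include hw in
/-- **KOTTWITZ'S EULER–POINCARÉ FUNCTION ON `U(Φ₂)(L⁺_v)` FROM (E) AND (N) AT THE RAMIFIED LEVELS**: for every two-sided Haar `ν` and canonical `m`, (E) and (N) at
`(K♯_D, K, K♯_D ⊓ K)` give `f ∈ C_c^∞(U₂)` with `Φ(⟦γ⟧, f) = 1` at every regular elliptic class and `= 0` at every regular non-elliptic class — the body of the letter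
★ `RankOneEulerPoincareNonsplit` at `(L, v, ν, m)` (★ glue `exists_isLocSmooth_classOrbitalIntegral_eq_one_zero_of_relations_two`); feeds the `hram` residue of ★
`rankOneEulerPoincareNonsplit_of_dyadic_of_ramified`. [cite: Kottwitz1988, §2 Theorem 2] [cite: Rogawski1990, §12.6 p. 174; §12.7 Lemma 12.7.1 p. 176] -/
theorem exists_isLocSmooth_classOrbitalIntegral_eq_one_zero_of_vertexEdgeLevels
    {m : OrbitalMeasureFamily ((cmDatum L 2 (Matrix.of fun i j : Fin 2 => if i.val + j.val + 1 = 2 then (1 : L) else 0)).Local v)}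
    (hm : m.IsCanonical (fun γ => IsRegularElt (γ.val : GL (Fin 2) (UnitaryGroup.LocalRing L v))) ν)
    (hE : ∀ γ : (cmDatum L 2 (Matrix.of fun i j : Fin 2 => if i.val + j.val + 1 = 2 then (1 : L) else 0)).Local v,
      IsRegularElt (γ.val : GL (Fin 2) (UnitaryGroup.LocalRing L v)) →
      CompactSpace (Subgroup.centralizer ({γ} : Set ((cmDatum L 2 (Matrix.of fun i j : Fin 2 => if i.val + j.val + 1 = 2 then (1 : L) else 0)).Local v))) →
      Nat.card (fixedBy ((cmDatum L 2 (Matrix.of fun i j : Fin 2 => if i.val + j.val + 1 = 2 then (1 : L) else 0)).Local v ⧸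
          (((glInt 2 (w.1.adicCompletion L)).map (MulAut.conj D).toMonoidHom).comap
          (((unitaryGroupOfForm (galAdicCompletionMap (L := L) (IsCMField.complexConj L) hw)
            (placeForm (Matrix.of fun i j : Fin 2 => if i.val + j.val + 1 = 2 then (1 : L) else 0) w.1)).subtype.comp
            (localNonsplitEquiv (IsCMField.complexConj L) (Matrix.of fun i j : Fin 2 => if i.val + j.val + 1 = 2 then (1 : L) else 0)
          (IsCMField.complexConj_ne_one L) w hw).toMonoidHom :
            (cmDatum L 2 (Matrix.of fun i j : Fin 2 => if i.val + j.val + 1 = 2 then (1 : L) else 0)).Local v →* GL (Fin 2) (w.1.adicCompletion L))))) γ) +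
        Nat.card (fixedBy ((cmDatum L 2 (Matrix.of fun i j : Fin 2 => if i.val + j.val + 1 = 2 then (1 : L) else 0)).Local v ⧸
          cmLocalIntegralLevel L 2 (Matrix.of fun i j : Fin 2 => if i.val + j.val + 1 = 2 then (1 : L) else 0) v) γ) =
        Nat.card (fixedBy ((cmDatum L 2 (Matrix.of fun i j : Fin 2 => if i.val + j.val + 1 = 2 then (1 : L) else 0)).Local v ⧸
          ((((glInt 2 (w.1.adicCompletion L)).map (MulAut.conj D).toMonoidHom).comap
          (((unitaryGroupOfForm (galAdicCompletionMap (L := L) (IsCMField.complexConj L) hw)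
            (placeForm (Matrix.of fun i j : Fin 2 => if i.val + j.val + 1 = 2 then (1 : L) else 0) w.1)).subtype.comp
            (localNonsplitEquiv (IsCMField.complexConj L) (Matrix.of fun i j : Fin 2 => if i.val + j.val + 1 = 2 then (1 : L) else 0)
          (IsCMField.complexConj_ne_one L) w hw).toMonoidHom :
            (cmDatum L 2 (Matrix.of fun i j : Fin 2 => if i.val + j.val + 1 = 2 then (1 : L) else 0)).Local v →* GL (Fin 2) (w.1.adicCompletion L)))) ⊓
            cmLocalIntegralLevel L 2 (Matrix.of fun i j : Fin 2 => if i.val + j.val + 1 = 2 then (1 : L) else 0) v)) γ) + 1)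
    (hN : ∀ γ : (cmDatum L 2 (Matrix.of fun i j : Fin 2 => if i.val + j.val + 1 = 2 then (1 : L) else 0)).Local v,
      IsRegularElt (γ.val : GL (Fin 2) (UnitaryGroup.LocalRing L v)) →
      ¬ CompactSpace (Subgroup.centralizer ({γ} : Set ((cmDatum L 2 (Matrix.of fun i j : Fin 2 => if i.val + j.val + 1 = 2 then (1 : L) else 0)).Local v))) →
      (((ν ((((glInt 2 (w.1.adicCompletion L)).map (MulAut.conj D).toMonoidHom).comap
          (((unitaryGroupOfForm (galAdicCompletionMap (L := L) (IsCMField.complexConj L) hw)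
            (placeForm (Matrix.of fun i j : Fin 2 => if i.val + j.val + 1 = 2 then (1 : L) else 0) w.1)).subtype.comp
            (localNonsplitEquiv (IsCMField.complexConj L) (Matrix.of fun i j : Fin 2 => if i.val + j.val + 1 = 2 then (1 : L) else 0)
          (IsCMField.complexConj_ne_one L) w hw).toMonoidHom :
            (cmDatum L 2 (Matrix.of fun i j : Fin 2 => if i.val + j.val + 1 = 2 then (1 : L) else 0)).Local v →* GL (Fin 2) (w.1.adicCompletion L)))))).toReal : ℂ))⁻¹ *
          classOrbitalIntegral m
            ((((((glInt 2 (w.1.adicCompletion L)).map (MulAut.conj D).toMonoidHom).comap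
          (((unitaryGroupOfForm (galAdicCompletionMap (L := L) (IsCMField.complexConj L) hw)
            (placeForm (Matrix.of fun i j : Fin 2 => if i.val + j.val + 1 = 2 then (1 : L) else 0) w.1)).subtype.comp
            (localNonsplitEquiv (IsCMField.complexConj L) (Matrix.of fun i j : Fin 2 => if i.val + j.val + 1 = 2 then (1 : L) else 0)
          (IsCMField.complexConj_ne_one L) w hw).toMonoidHom :
            (cmDatum L 2 (Matrix.of fun i j : Fin 2 => if i.val + j.val + 1 = 2 then (1 : L) else 0)).Local v →* GL (Fin 2) (w.1.adicCompletion L)))) : Subgroup ((cmDatum L 2 (Matrix.of fun i j : Fin 2 => if i.val + j.val + 1 = 2 then (1 : L) else 0)).Local v)) : Set ((cmDatum L 2 (Matrix.of fun i j : Fin 2 => if i.val + j.val + 1 = 2 then (1 : L) else 0)).Local v)).indicator fun _ => (1 : ℂ))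
            (ConjClasses.mk γ) +
        (((ν (cmLocalIntegralLevel L 2 (Matrix.of fun i j : Fin 2 => if i.val + j.val + 1 = 2 then (1 : L) else 0) v)).toReal : ℂ))⁻¹ *
          classOrbitalIntegral m
            (((cmLocalIntegralLevel L 2 (Matrix.of fun i j : Fin 2 => if i.val + j.val + 1 = 2 then (1 : L) else 0) v) : Set ((cmDatum L 2 (Matrix.of fun i j : Fin 2 => if i.val + j.val + 1 = 2 then (1 : L) else 0)).Local v)).indicator fun _ => (1 : ℂ))
            (ConjClasses.mk γ) -
        (((ν ((((glInt 2 (w.1.adicCompletion L)).map (MulAut.conj D).toMonoidHom).comap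
          (((unitaryGroupOfForm (galAdicCompletionMap (L := L) (IsCMField.complexConj L) hw)
            (placeForm (Matrix.of fun i j : Fin 2 => if i.val + j.val + 1 = 2 then (1 : L) else 0) w.1)).subtype.comp
            (localNonsplitEquiv (IsCMField.complexConj L) (Matrix.of fun i j : Fin 2 => if i.val + j.val + 1 = 2 then (1 : L) else 0)
          (IsCMField.complexConj_ne_one L) w hw).toMonoidHom :
            (cmDatum L 2 (Matrix.of fun i j : Fin 2 => if i.val + j.val + 1 = 2 then (1 : L) else 0)).Local v →* GL (Fin 2) (w.1.adicCompletion L)))) ⊓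
            cmLocalIntegralLevel L 2 (Matrix.of fun i j : Fin 2 => if i.val + j.val + 1 = 2 then (1 : L) else 0) v)).toReal : ℂ))⁻¹ *
          classOrbitalIntegral m
            ((((((glInt 2 (w.1.adicCompletion L)).map (MulAut.conj D).toMonoidHom).comap
          (((unitaryGroupOfForm (galAdicCompletionMap (L := L) (IsCMField.complexConj L) hw)
            (placeForm (Matrix.of fun i j : Fin 2 => if i.val + j.val + 1 = 2 then (1 : L) else 0) w.1)).subtype.comp
            (localNonsplitEquiv (IsCMField.complexConj L) (Matrix.of fun i j : Fin 2 => if i.val + j.val + 1 = 2 then (1 : L) else 0)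
          (IsCMField.complexConj_ne_one L) w hw).toMonoidHom :
            (cmDatum L 2 (Matrix.of fun i j : Fin 2 => if i.val + j.val + 1 = 2 then (1 : L) else 0)).Local v →* GL (Fin 2) (w.1.adicCompletion L)))) ⊓
              cmLocalIntegralLevel L 2 (Matrix.of fun i j : Fin 2 => if i.val + j.val + 1 = 2 then (1 : L) else 0) v : Subgroup ((cmDatum L 2 (Matrix.of fun i j : Fin 2 => if i.val + j.val + 1 = 2 then (1 : L) else 0)).Local v)) : Set ((cmDatum L 2 (Matrix.of fun i j : Fin 2 => if i.val + j.val + 1 = 2 then (1 : L) else 0)).Local v)).indicator fun _ => (1 : ℂ))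
            (ConjClasses.mk γ) = 0) :
    ∃ f : (cmDatum L 2 (Matrix.of fun i j : Fin 2 => if i.val + j.val + 1 = 2 then (1 : L) else 0)).Local v → ℂ, IsLocSmooth f ∧
      (∀ γ : (cmDatum L 2 (Matrix.of fun i j : Fin 2 => if i.val + j.val + 1 = 2 then (1 : L) else 0)).Local v,
          IsRegularElt (γ.val : GL (Fin 2) (UnitaryGroup.LocalRing L v)) →
          CompactSpace (Subgroup.centralizer ({γ} : Set ((cmDatum L 2 (Matrix.of fun i j : Fin 2 => if i.val + j.val + 1 = 2 then (1 : L) else 0)).Local v))) →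
          classOrbitalIntegral m f (ConjClasses.mk γ) = 1) ∧
      (∀ γ : (cmDatum L 2 (Matrix.of fun i j : Fin 2 => if i.val + j.val + 1 = 2 then (1 : L) else 0)).Local v,
          IsRegularElt (γ.val : GL (Fin 2) (UnitaryGroup.LocalRing L v)) →
          ¬ CompactSpace (Subgroup.centralizer ({γ} : Set ((cmDatum L 2 (Matrix.of fun i j : Fin 2 => if i.val + j.val + 1 = 2 then (1 : L) else 0)).Local v))) →
          classOrbitalIntegral m f (ConjClasses.mk γ) = 0) := by
  obtain ⟨K₁, K₂, I, h1o, h1c, h2o, h2c, hIo, hIc, hE', hN'⟩ := exists_epRelations_of_vertexEdgeLevels L w hw D ν hE hN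
  exact exists_isLocSmooth_classOrbitalIntegral_eq_one_zero_of_relations_two L v ν hm K₁ K₂ I h1o h1c h2o h2c hIo hIc hE' hN'

end Package

end Literature.NumberTheory.Rogawski1990

end
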